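/-
Copyright: cell `langlands-arthur-audit` (papers/Langlands/langlands-arthur-audit), unit `pub-arthur-carver` (gen 7).
Staged for the tree under `Literature/NumberTheory/Automorphic/KMSW2014/` (LEAN-IN-TREE rule 2026-08-18);
companion of `KMSW2014/DependencyDag.lean` (tree, p176227 / p176926 / p177283) and `KMSW2014/FineDag.lean`
(p177459 / v1.1 p179301) — imports the latter and certifies, leaf by leaf, the CONVERSE ("only if") half of the
conditional readings `Nodes.scope_conditional_form` / `Nodes.full_of_leaves`: in the dependency DAG AS TYPED by
those two modules, which of the 14 leaves are load-bearing for the proved scope and for the full statements.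
Generated by the cell script `pub-arthur-carver-g7/gen_support2.py kmsw` from the two tree modules (declaration
order, edge constants, bundles); every generated table is re-certified by the kernel (`decide`), none is trusted.
Sister file of `Arthur2013/LeafSupport.lean` (p179578), same method.  v1.0a (unit `pub-arthur-carver-g8`,
DOCSTRING-ONLY): the atom counts in the `LeafSupport.necessary` paragraph corrected to `Nodes` (27) / `Waypoints`
(26) (cell GAPS G-REF-g19-1); no declaration changed.
-/
import Literature.NumberTheory.Automorphic.KMSW2014.FineDag
import Literature.NumberTheory.Automorphic.LeafSupportKit

/-!
# Kaletha–Mínguez–Shin–White (2014) — leaf support of the kernel dependency DAG (countermodel certificates)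

**Source reproduced.** T. Kaletha, A. Mínguez, S. W. Shin, P.-J. White, *Endoscopic classification of
representations: inner forms of unitary groups*, arXiv:1409.3731v3 [cite: KalethaMinguezShinWhite2014] —
nothing beyond what `KMSW2014/DependencyDag.lean` (chapter edges) and `KMSW2014/FineDag.lean` (result-level
fine edges, premise-audited first-hand against the held TeX in v1.1) already transcribe.  This file adds NO
edge, NO node and NO leaf; it reads the 43 edge constants of those modules and proves facts about them.

**What this file is.**  No mathematics of automorphic forms is formalised.  The two DAG modules prove the "if"
direction of the cell's conditional readings: KMSW's PROVED SCOPE at every rank (`Scope N` = Theorem* 1.6.1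
for generic parameters `T161g`, the local intertwining relation for bounded parameters with E/F a field
`LIRg`, Theorem 5.0.1 for generic ψ on pure inner twists `T171p`) follows from the edges, the Mok import, the
published leaves and the general weighted fundamental lemma (`scope_of_leaves`, `scope_of_leaves_fine`,
`scope_conditional_form`), and the FULL starred statements (`Full N` = `T161`, `LIR`, `T171`) need in addition
the two unwritten sequels [KMS_A], [KMS_B] (`full_of_leaves`, edge `E_Full`).  This file settles the "only if"
half for the DAG AS TYPED, by 14 kernel-checked countermodels:

* `LeafSupport.leaf_essential` — for each of the 14 leaves `l` (10 published, the Mok import `MokMain`, the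
  unwritten `WFL_general`, the two unwritten sequels) there are `Nodes`/`Waypoints` satisfying EVERY
  edge-hypothesis bundle of the two modules (`ChapterEdges`, `SupplyEdges`, `FineEdges`, `Readings` — packaged
  as `LeafSupport.Systems`) and every OTHER leaf, in which `l` fails and NONE of the three FULL statements holds
  at ANY rank (`not_derivable_without`): every leaf of `full_of_leaves` is load-bearing.
* `LeafSupport.leaf_essential_scope` — for every leaf EXCEPT `AubertSS`, `KMS_A`, `KMS_B` the same countermodel
  refutes also the three PROVED-SCOPE statements at every rank (`not_derivable_scope_without`).  That the two
  sequels are not needed for the proved scope is the point of the `UnwrittenLeaves` / `UnwrittenSequels` split of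
  `DependencyDag.lean`; that the published leaf `AubertSS` (KL11: the inputs of Appendix A — the Aubert /
  Schneider–Stuhler involution, second adjointness, the Plancherel formula, Ban's split case) is not needed
  either is a finding about the transcription: it is a premise of the single edge `E_AppA`
  (Appendix A), whose output `AppA` is consumed only by the deferral edge `E_Full` — matching the paper's own
  placement of Appendix A as "an input in the sequels" (main.tex l.89, quoted in the `E_Full` docstring).  So
  `scope_of_leaves` / `scope_of_leaves_fine` carry the field `PublishedLeaves.aubert` idly, and the least-model
  support of the proved scope is exactly 11 leaves: the nine other published leaves, `MokMain`, `WFL_general`.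
* `LeafSupport.necessary` — the same 14 countermodels give the NECESSITY half of the support of every one of the
  53 atoms (fields of `Nodes` (27) and `Waypoints` (26); v1.0 printed the two counts transposed as 25/28 — corrected
  v1.0a, cell GAPS G-REF-g19-1): leaf `l` is needed for atom `a` whenever bit `a.idx` of
  the numeral `cm l` is clear (`necessary l a (by decide)`).  Least-model supports so obtained (script-computed,
  each entry certifiable by that lemma; SUFFICIENCY at fixed rank given the induction hypothesis holds in the
  propositional abstraction but is NOT asserted by this file):
  - main theorems: `T161g` (11) = all but {AubertSS, KMS_A, KMS_B}; `LIRg` (11) = all but {AubertSS, KMS_A, KMS_B};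
    `T171p` (11) = all but {AubertSS, KMS_A, KMS_B}; `T161` (14) = all 14; `LIR` (14) = all 14; `T171` (14) = all
    14.
  - intermediate nodes (rank-indexed ones at fixed rank, IH granted): `StabOrdI` (5) = {Transfer, FL, WFL_split,
    STF_Arthur, WFL_general}; `T164` (3) = {GL_inner, Transfer, EPIT_published}; `AppA` (2) = {TF_analytic,
    AubertSS}; `Ch1` (4) = {GL_inner, Transfer, EPIT_published, MokMain}; `Glob` (7) = {GL_inner, Transfer,
    TF_analytic, EPIT_published, Glob_inputs, Ar_args, MokMain}; `Ch2` (7) = {GL_inner, Transfer, TF_analytic,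
    EPIT_published, Glob_inputs, Ar_args, MokMain}; `Ch3` (11) = all but {AubertSS, KMS_A, KMS_B}.
  - waypoints (`FineDag.lean`): `K22` (7) = {GL_inner, Transfer, TF_analytic, EPIT_published, Glob_inputs, Ar_args,
    MokMain}; `K23` (7) = {GL_inner, Transfer, TF_analytic, EPIT_published, Glob_inputs, Ar_args, MokMain}; `K24`
    (7) = {GL_inner, Transfer, TF_analytic, EPIT_published, Glob_inputs, Ar_args, MokMain}; `K25` (7) = {GL_inner,
    Transfer, TF_analytic, EPIT_published, Glob_inputs, Ar_args, MokMain}; `K26` (7) = {GL_inner, Transfer,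
    TF_analytic, EPIT_published, Glob_inputs, Ar_args, MokMain}; `K27` (7) = {GL_inner, Transfer, TF_analytic,
    EPIT_published, Glob_inputs, Ar_args, MokMain}; `K28` (7) = {GL_inner, Transfer, TF_analytic, EPIT_published,
    Glob_inputs, Ar_args, MokMain}; `K29` (7) = {GL_inner, Transfer, TF_analytic, EPIT_published, Glob_inputs,
    Ar_args, MokMain}; `K31` (10) = all but {Glob_inputs, AubertSS, KMS_A, KMS_B}; `K32` (10) = all but
    {Glob_inputs, AubertSS, KMS_A, KMS_B}; `K33` (10) = all but {Glob_inputs, AubertSS, KMS_A, KMS_B}; `K34` (5) =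
    {GL_inner, Transfer, TF_analytic, EPIT_published, MokMain}; `K35` (11) = all but {AubertSS, KMS_A, KMS_B}; `K36`
    (11) = all but {AubertSS, KMS_A, KMS_B}; `K37` (11) = all but {AubertSS, KMS_A, KMS_B}; `K38` (11) = all but
    {AubertSS, KMS_A, KMS_B}; `K41` (5) = {GL_inner, Transfer, EPIT_published, Ar_args, MokMain}; `K42` (5) =
    {GL_inner, Transfer, EPIT_published, Glob_inputs, MokMain}; `K43` (5) = {GL_inner, Transfer, EPIT_published,
    Glob_inputs, MokMain}; `K44` (7) = {GL_inner, Transfer, TF_analytic, EPIT_published, Glob_inputs, Ar_args,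
    MokMain}; `K45` (11) = all but {AubertSS, KMS_A, KMS_B}; `K46` (11) = all but {AubertSS, KMS_A, KMS_B}; `K47`
    (11) = all but {AubertSS, KMS_A, KMS_B}; `K48` (11) = all but {AubertSS, KMS_A, KMS_B}; `K49` (11) = all but
    {AubertSS, KMS_A, KMS_B}; `K50` (11) = all but {AubertSS, KMS_A, KMS_B}.

**Method (reflective, all bookkeeping)** — identical to `Arthur2013/LeafSupport.lean`, with the generic Boolean
clause kit (`bit`, `allP`/`allB`, `noneP`/`noneB`, `okE`, `sound`) imported from `LeafSupportKit.lean`.  An `Atom` is one of the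
53 fields of `Nodes` and `Waypoints`; a valuation is a numeral `v : Nat` (atom `a` true iff bit `a.idx` is set)
and `mkN v`, `mkW v` are the structures it determines (rank-indexed fields constant in the rank).  Each of the
43 edge constants is a Horn clause "premise atoms ⟹ conclusion atom(s)" once the rank binder and the
induction-hypothesis premise `ν.IH N` are dropped — legitimate for constant valuations, and conservative: a model
found WITH `IH` granted is a model of the edge as typed (the aggregate premise `ν.Everything N` of `E_Full` is
read as the conjunction of its seven atoms).  `systems_of_check` proves ONCE, symbolically in `v`, that the
Boolean clause check `checkAll v` implies all four bundles for `mkN v, mkW v` (one term per bundle field,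
elaborated against the edge constant itself, so a mis-transcribed clause would not typecheck); each
countermodel is then `decide` on a numeral.  The numerals `cm l` are the least models (forward chaining from the
other 13 leaves), computed by the cell script and certified here, not trusted.
SCOPE CAVEATS. (i) "Essential" is relative to the transcription; a finer or corrected transcription is judged by
re-running the script, which regenerates this file from the modules.  (ii) At fixed rank with `IH N` granted —
the strongest position for dropping a leaf; across ranks supports can only grow.  (iii) The joint system with
Mok (`KMSW2014/WithMok.lean`, where `MokMain` is discharged to Mok's `Everything` by `E_ImportMok` and the two
copies of `WFL_general` are identified by `E_SameWFL`) is not treated here: there `MokMain` unfolds to Mok's own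
leaves, all 29 of which are load-bearing for Mok's global theorems (`Mok2015/LeafSupport.lean`).  (iv) Over the
chapter-level system `ChapterEdges` + `SupplyEdges` alone (the hypotheses of `Nodes.scope_of_leaves`) every
certificate below holds a fortiori (fewer hypotheses to satisfy).

Axioms: every theorem of this file is closed or uses only `propext` (via `simp`/`decide`); `Classical.choice`
is not needed, and no compiled evaluation (`Lean.ofReduceBool`) is used — every certificate is kernel `decide`.
-/

namespace Literature.NumberTheory.Automorphic.KMSW2014

namespace LeafSupport

open Literature.NumberTheory.Automorphic.LeafSupportKit

/-! ## 1. Atoms: one constant per field of `Nodes` (27) + `Waypoints` (26) -/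

/-- The 53 atoms of the kernel DAG = the fields of `Nodes` (27) + `Waypoints` (26), in declaration order; rank-indexed fields are read at one fixed rank. [folklore] (bookkeeping) -/
inductive Atom where
  | MokMain | GL_inner | Transfer | FL | WFL_split | STF_Arthur | TF_analytic | EPIT_published | Glob_inputs
  | AubertSS | Ar_args | WFL_general | KMS_A | KMS_B | StabOrdI | T164 | AppA | T161g | LIRg | T171p | T161 | LIR
  | T171 | Ch1 | Glob | Ch2 | Ch3 | K22 | K23 | K24 | K25 | K26 | K27 | K28 | K29 | K31 | K32 | K33 | K34 | K35 | K36
  | K37 | K38 | K41 | K42 | K43 | K44 | K45 | K46 | K47 | K48 | K49 | K50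

/-- Bit position of an atom in a valuation numeral (= its declaration index, 0–52). [folklore] (bookkeeping) -/
def Atom.idx : Atom → Nat
  | .MokMain => 0 | .GL_inner => 1 | .Transfer => 2 | .FL => 3 | .WFL_split => 4 | .STF_Arthur => 5
  | .TF_analytic => 6 | .EPIT_published => 7 | .Glob_inputs => 8 | .AubertSS => 9 | .Ar_args => 10
  | .WFL_general => 11 | .KMS_A => 12 | .KMS_B => 13 | .StabOrdI => 14 | .T164 => 15 | .AppA => 16 | .T161g => 17
  | .LIRg => 18 | .T171p => 19 | .T161 => 20 | .LIR => 21 | .T171 => 22 | .Ch1 => 23 | .Glob => 24 | .Ch2 => 25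
  | .Ch3 => 26 | .K22 => 27 | .K23 => 28 | .K24 => 29 | .K25 => 30 | .K26 => 31 | .K27 => 32 | .K28 => 33
  | .K29 => 34 | .K31 => 35 | .K32 => 36 | .K33 => 37 | .K34 => 38 | .K35 => 39 | .K36 => 40 | .K37 => 41
  | .K38 => 42 | .K41 => 43 | .K42 => 44 | .K43 => 45 | .K44 => 46 | .K45 => 47 | .K46 => 48 | .K47 => 49
  | .K48 => 50 | .K49 => 51 | .K50 => 52

/-- Interpretation of an atom in given `Nodes` / `Waypoints` at rank `N` (rank-free fields ignore `N`). [folklore] (bookkeeping) -/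
def Atom.prop (ν : Nodes) (ω : Waypoints) (N : Nat) : Atom → Prop
  | .MokMain => ν.MokMain | .GL_inner => ν.GL_inner | .Transfer => ν.Transfer | .FL => ν.FL
  | .WFL_split => ν.WFL_split | .STF_Arthur => ν.STF_Arthur | .TF_analytic => ν.TF_analytic
  | .EPIT_published => ν.EPIT_published | .Glob_inputs => ν.Glob_inputs | .AubertSS => ν.AubertSS
  | .Ar_args => ν.Ar_args | .WFL_general => ν.WFL_general | .KMS_A => ν.KMS_A | .KMS_B => ν.KMS_B
  | .StabOrdI => ν.StabOrdI | .T164 => ν.T164 | .AppA => ν.AppA | .T161g => ν.T161g N | .LIRg => ν.LIRg N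
  | .T171p => ν.T171p N | .T161 => ν.T161 N | .LIR => ν.LIR N | .T171 => ν.T171 N | .Ch1 => ν.Ch1 N
  | .Glob => ν.Glob N | .Ch2 => ν.Ch2 N | .Ch3 => ν.Ch3 N | .K22 => ω.K22 N | .K23 => ω.K23 N | .K24 => ω.K24 N
  | .K25 => ω.K25 N | .K26 => ω.K26 N | .K27 => ω.K27 N | .K28 => ω.K28 N | .K29 => ω.K29 N | .K31 => ω.K31 N
  | .K32 => ω.K32 N | .K33 => ω.K33 N | .K34 => ω.K34 N | .K35 => ω.K35 N | .K36 => ω.K36 N | .K37 => ω.K37 N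
  | .K38 => ω.K38 N | .K41 => ω.K41 N | .K42 => ω.K42 N | .K43 => ω.K43 N | .K44 => ω.K44 N | .K45 => ω.K45 N
  | .K46 => ω.K46 N | .K47 => ω.K47 N | .K48 => ω.K48 N | .K49 => ω.K49 N | .K50 => ω.K50 N

/-! ## 2. Boolean valuations -/

/-- The `Nodes` determined by the valuation numeral `v` (rank-indexed fields constant in the rank). [folklore] (bookkeeping) -/
def mkN (v : Nat) : Nodes where
  MokMain := bit Atom.idx v .MokMain
  GL_inner := bit Atom.idx v .GL_inner
  Transfer := bit Atom.idx v .Transfer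
  FL := bit Atom.idx v .FL
  WFL_split := bit Atom.idx v .WFL_split
  STF_Arthur := bit Atom.idx v .STF_Arthur
  TF_analytic := bit Atom.idx v .TF_analytic
  EPIT_published := bit Atom.idx v .EPIT_published
  Glob_inputs := bit Atom.idx v .Glob_inputs
  AubertSS := bit Atom.idx v .AubertSS
  Ar_args := bit Atom.idx v .Ar_args
  WFL_general := bit Atom.idx v .WFL_general
  KMS_A := bit Atom.idx v .KMS_A
  KMS_B := bit Atom.idx v .KMS_B
  StabOrdI := bit Atom.idx v .StabOrdI
  T164 := bit Atom.idx v .T164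
  AppA := bit Atom.idx v .AppA
  T161g := fun _ => bit Atom.idx v .T161g
  LIRg := fun _ => bit Atom.idx v .LIRg
  T171p := fun _ => bit Atom.idx v .T171p
  T161 := fun _ => bit Atom.idx v .T161
  LIR := fun _ => bit Atom.idx v .LIR
  T171 := fun _ => bit Atom.idx v .T171
  Ch1 := fun _ => bit Atom.idx v .Ch1
  Glob := fun _ => bit Atom.idx v .Glob
  Ch2 := fun _ => bit Atom.idx v .Ch2
  Ch3 := fun _ => bit Atom.idx v .Ch3

/-- The `Waypoints` determined by the valuation numeral `v` (rank-indexed fields constant in the rank). [folklore] (bookkeeping) -/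
def mkW (v : Nat) : Waypoints where
  K22 := fun _ => bit Atom.idx v .K22
  K23 := fun _ => bit Atom.idx v .K23
  K24 := fun _ => bit Atom.idx v .K24
  K25 := fun _ => bit Atom.idx v .K25
  K26 := fun _ => bit Atom.idx v .K26
  K27 := fun _ => bit Atom.idx v .K27
  K28 := fun _ => bit Atom.idx v .K28
  K29 := fun _ => bit Atom.idx v .K29
  K31 := fun _ => bit Atom.idx v .K31
  K32 := fun _ => bit Atom.idx v .K32
  K33 := fun _ => bit Atom.idx v .K33
  K34 := fun _ => bit Atom.idx v .K34
  K35 := fun _ => bit Atom.idx v .K35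
  K36 := fun _ => bit Atom.idx v .K36
  K37 := fun _ => bit Atom.idx v .K37
  K38 := fun _ => bit Atom.idx v .K38
  K41 := fun _ => bit Atom.idx v .K41
  K42 := fun _ => bit Atom.idx v .K42
  K43 := fun _ => bit Atom.idx v .K43
  K44 := fun _ => bit Atom.idx v .K44
  K45 := fun _ => bit Atom.idx v .K45
  K46 := fun _ => bit Atom.idx v .K46
  K47 := fun _ => bit Atom.idx v .K47
  K48 := fun _ => bit Atom.idx v .K48
  K49 := fun _ => bit Atom.idx v .K49
  K50 := fun _ => bit Atom.idx v .K50

/-- Under the valuation structures every atom reads as its bit. [folklore] (bookkeeping) -/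
theorem prop_mk (v N : Nat) : ∀ a : Atom, a.prop (mkN v) (mkW v) N ↔ bit Atom.idx v a := by
  intro a; cases a <;> exact Iff.rfl

/-! ## 3. The edge system: every edge-hypothesis bundle of the module(s) -/

/-- ALL edge hypotheses at once: the bundles `ChapterEdges`, `SupplyEdges`, `FineEdges`, `Readings` — 4 bundles, 43 fields, 43 distinct edge
constants; a superset of the hypotheses of each landed composition theorem of the module(s). [folklore] (bookkeeping: packaging of the transcribed edges) -/
structure Systems (ν : Nodes) (ω : Waypoints) : Prop where
  chapter : ν.ChapterEdges
  supply : ν.SupplyEdges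
  fine : ω.FineEdges ν
  readings : ω.Readings ν

/-- The 43 clauses (premise atoms ⟹ conclusion atoms) read off the edge constants, as Boolean checks on a valuation numeral;
`IH N` and the rank binder are dropped (a valuation is constant in the rank, and `IH 0` holds). [folklore] (bookkeeping) -/
structure Oks (v : Nat) : Prop where
  chapter_ch1 : okE Atom.idx v [.MokMain, .GL_inner, .Transfer, .EPIT_published, .T164] [.Ch1] = true
  chapter_glob : okE Atom.idx v [.Ch1, .MokMain, .TF_analytic, .Glob_inputs, .EPIT_published, .Transfer, .Ar_args] [.Glob] = true
  chapter_ch2 : okE Atom.idx v [.Ch1, .Glob, .T164, .MokMain, .TF_analytic, .Transfer, .EPIT_published, .Ar_args] [.Ch2] = true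
  chapter_ch3 : okE Atom.idx v [.Ch1, .Ch2, .MokMain, .StabOrdI, .TF_analytic, .GL_inner, .Transfer, .FL, .EPIT_published, .Ar_args] [.Ch3] = true
  chapter_ch4lir : okE Atom.idx v [.Ch1, .Ch2, .Ch3, .Glob, .MokMain, .TF_analytic, .Transfer, .EPIT_published, .Ar_args] [.LIRg] = true
  chapter_ch4loc : okE Atom.idx v [.Ch1, .Ch2, .Ch3, .Glob, .LIRg, .MokMain, .TF_analytic, .Transfer, .EPIT_published, .Ar_args] [.T161g] = true
  chapter_ch5 : okE Atom.idx v [.Ch1, .Ch3, .T161g, .LIRg, .MokMain, .T164] [.T171p] = true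
  supply_stabOrd : okE Atom.idx v [.FL, .WFL_split, .WFL_general, .STF_Arthur, .Transfer] [.StabOrdI] = true
  supply_t164 : okE Atom.idx v [.GL_inner, .Transfer, .EPIT_published] [.T164] = true
  supply_appA : okE Atom.idx v [.AubertSS, .TF_analytic] [.AppA] = true
  supply_full : okE Atom.idx v [.KMS_A, .KMS_B, .AppA, .Ch1, .Glob, .Ch2, .Ch3, .T161g, .LIRg, .T171p] [.T161, .LIR, .T171] = true
  fine_kf41 : okE Atom.idx v [.Ch1, .EPIT_published, .Ar_args] [.K41] = true
  fine_kf42 : okE Atom.idx v [.Ch1, .Glob_inputs] [.K42] = true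
  fine_kf43 : okE Atom.idx v [.Ch1, .MokMain, .K42] [.K43] = true
  fine_kf22 : okE Atom.idx v [.Ch1, .MokMain, .TF_analytic, .EPIT_published, .Ar_args, .K42] [.K22] = true
  fine_kf23 : okE Atom.idx v [.Ch1, .Transfer, .EPIT_published, .TF_analytic, .Ar_args, .K22] [.K23] = true
  fine_kf24 : okE Atom.idx v [.Ch1, .T164, .MokMain, .Transfer, .EPIT_published, .Ar_args, .K22, .K23] [.K24] = true
  fine_kf25 : okE Atom.idx v [.Ch1, .K22, .K23, .K24] [.K25] = true
  fine_kf26 : okE Atom.idx v [.Ch1, .MokMain, .Transfer, .Ar_args, .K22, .K23, .K24, .K25] [.K26] = true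
  fine_kf27 : okE Atom.idx v [.Ch1, .MokMain, .Transfer, .Ar_args, .K22, .K23, .K24, .K25, .K26] [.K27] = true
  fine_kf28 : okE Atom.idx v [.Ch1, .MokMain, .EPIT_published, .Ar_args, .K25, .K26, .K27] [.K28] = true
  fine_kf29 : okE Atom.idx v [.Ch1, .Transfer, .EPIT_published, .TF_analytic, .K24, .K25, .K26] [.K29] = true
  fine_kf44 : okE Atom.idx v [.Ch1, .Ch2, .MokMain, .EPIT_published, .Ar_args, .K41, .K43] [.K44] = true
  fine_kf31 : okE Atom.idx v [.Ch1, .StabOrdI, .TF_analytic, .Transfer, .FL, .Ar_args] [.K31] = true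
  fine_kf32 : okE Atom.idx v [.TF_analytic, .Ar_args, .K31] [.K32] = true
  fine_kf33 : okE Atom.idx v [.Ch1, .MokMain, .TF_analytic, .Ar_args, .K31] [.K33] = true
  fine_kf34 : okE Atom.idx v [.Ch1, .GL_inner, .TF_analytic] [.K34] = true
  fine_kf35 : okE Atom.idx v [.Ch1, .Ch2, .MokMain, .GL_inner, .Transfer, .Ar_args, .K31, .K33, .K34] [.K35] = true
  fine_kf36 : okE Atom.idx v [.Ch1, .Ch2, .MokMain, .Transfer, .Ar_args, .K31, .K33, .K35] [.K36] = true
  fine_kf37 : okE Atom.idx v [.Ch1, .Ch2, .Ar_args, .K35, .K36] [.K37] = true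
  fine_kf38 : okE Atom.idx v [.MokMain, .Ar_args, .K36, .K37] [.K38] = true
  fine_kf45 : okE Atom.idx v [.Ch3, .Glob, .MokMain, .TF_analytic, .Ar_args] [.K45] = true
  fine_kf46 : okE Atom.idx v [.Ch1, .Ch2, .Ch3, .Glob, .MokMain, .TF_analytic, .Ar_args, .K45] [.K46] = true
  fine_kf47 : okE Atom.idx v [.Ch1, .Ch2, .LIRg, .TF_analytic, .Transfer, .EPIT_published, .Ar_args, .K46] [.K47] = true
  fine_kf48 : okE Atom.idx v [.Ch1, .Ch2, .LIRg, .MokMain, .TF_analytic, .Transfer, .Ar_args, .K46] [.K48] = true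
  fine_kf49 : okE Atom.idx v [.Ch1, .Ch3, .Glob, .MokMain, .TF_analytic, .Transfer, .EPIT_published, .Ar_args, .K48] [.K49] = true
  fine_kf50 : okE Atom.idx v [.Ch1, .Ch3, .T161g, .LIRg, .MokMain, .T164] [.K50] = true
  readings_kr2 : okE Atom.idx v [.K22, .K23, .K24, .K25, .K26, .K27, .K28, .K29] [.Ch2] = true
  readings_krGlob : okE Atom.idx v [.K41, .K42, .K43, .K44] [.Glob] = true
  readings_kr3 : okE Atom.idx v [.K31, .K32, .K33, .K34, .K35, .K36, .K37, .K38] [.Ch3] = true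
  readings_krLIR : okE Atom.idx v [.K45, .K46] [.LIRg] = true
  readings_krLoc : okE Atom.idx v [.Ch1, .K47, .K48, .K49] [.T161g] = true
  readings_kr5 : okE Atom.idx v [.K50] [.T171p] = true

/-- Conjunction of the 43 clause checks. [folklore] (bookkeeping) -/
def checkAll (v : Nat) : Bool :=
  okE Atom.idx v [.MokMain, .GL_inner, .Transfer, .EPIT_published, .T164] [.Ch1] &&
  (okE Atom.idx v [.Ch1, .MokMain, .TF_analytic, .Glob_inputs, .EPIT_published, .Transfer, .Ar_args] [.Glob] &&
  (okE Atom.idx v [.Ch1, .Glob, .T164, .MokMain, .TF_analytic, .Transfer, .EPIT_published, .Ar_args] [.Ch2] &&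
  (okE Atom.idx v [.Ch1, .Ch2, .MokMain, .StabOrdI, .TF_analytic, .GL_inner, .Transfer, .FL, .EPIT_published, .Ar_args] [.Ch3] &&
  (okE Atom.idx v [.Ch1, .Ch2, .Ch3, .Glob, .MokMain, .TF_analytic, .Transfer, .EPIT_published, .Ar_args] [.LIRg] &&
  (okE Atom.idx v [.Ch1, .Ch2, .Ch3, .Glob, .LIRg, .MokMain, .TF_analytic, .Transfer, .EPIT_published, .Ar_args] [.T161g] &&
  (okE Atom.idx v [.Ch1, .Ch3, .T161g, .LIRg, .MokMain, .T164] [.T171p] &&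
  (okE Atom.idx v [.FL, .WFL_split, .WFL_general, .STF_Arthur, .Transfer] [.StabOrdI] &&
  (okE Atom.idx v [.GL_inner, .Transfer, .EPIT_published] [.T164] &&
  (okE Atom.idx v [.AubertSS, .TF_analytic] [.AppA] &&
  (okE Atom.idx v [.KMS_A, .KMS_B, .AppA, .Ch1, .Glob, .Ch2, .Ch3, .T161g, .LIRg, .T171p] [.T161, .LIR, .T171] &&
  (okE Atom.idx v [.Ch1, .EPIT_published, .Ar_args] [.K41] &&
  (okE Atom.idx v [.Ch1, .Glob_inputs] [.K42] &&
  (okE Atom.idx v [.Ch1, .MokMain, .K42] [.K43] &&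
  (okE Atom.idx v [.Ch1, .MokMain, .TF_analytic, .EPIT_published, .Ar_args, .K42] [.K22] &&
  (okE Atom.idx v [.Ch1, .Transfer, .EPIT_published, .TF_analytic, .Ar_args, .K22] [.K23] &&
  (okE Atom.idx v [.Ch1, .T164, .MokMain, .Transfer, .EPIT_published, .Ar_args, .K22, .K23] [.K24] &&
  (okE Atom.idx v [.Ch1, .K22, .K23, .K24] [.K25] &&
  (okE Atom.idx v [.Ch1, .MokMain, .Transfer, .Ar_args, .K22, .K23, .K24, .K25] [.K26] &&
  (okE Atom.idx v [.Ch1, .MokMain, .Transfer, .Ar_args, .K22, .K23, .K24, .K25, .K26] [.K27] &&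
  (okE Atom.idx v [.Ch1, .MokMain, .EPIT_published, .Ar_args, .K25, .K26, .K27] [.K28] &&
  (okE Atom.idx v [.Ch1, .Transfer, .EPIT_published, .TF_analytic, .K24, .K25, .K26] [.K29] &&
  (okE Atom.idx v [.Ch1, .Ch2, .MokMain, .EPIT_published, .Ar_args, .K41, .K43] [.K44] &&
  (okE Atom.idx v [.Ch1, .StabOrdI, .TF_analytic, .Transfer, .FL, .Ar_args] [.K31] &&
  (okE Atom.idx v [.TF_analytic, .Ar_args, .K31] [.K32] &&
  (okE Atom.idx v [.Ch1, .MokMain, .TF_analytic, .Ar_args, .K31] [.K33] &&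
  (okE Atom.idx v [.Ch1, .GL_inner, .TF_analytic] [.K34] &&
  (okE Atom.idx v [.Ch1, .Ch2, .MokMain, .GL_inner, .Transfer, .Ar_args, .K31, .K33, .K34] [.K35] &&
  (okE Atom.idx v [.Ch1, .Ch2, .MokMain, .Transfer, .Ar_args, .K31, .K33, .K35] [.K36] &&
  (okE Atom.idx v [.Ch1, .Ch2, .Ar_args, .K35, .K36] [.K37] &&
  (okE Atom.idx v [.MokMain, .Ar_args, .K36, .K37] [.K38] &&
  (okE Atom.idx v [.Ch3, .Glob, .MokMain, .TF_analytic, .Ar_args] [.K45] &&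
  (okE Atom.idx v [.Ch1, .Ch2, .Ch3, .Glob, .MokMain, .TF_analytic, .Ar_args, .K45] [.K46] &&
  (okE Atom.idx v [.Ch1, .Ch2, .LIRg, .TF_analytic, .Transfer, .EPIT_published, .Ar_args, .K46] [.K47] &&
  (okE Atom.idx v [.Ch1, .Ch2, .LIRg, .MokMain, .TF_analytic, .Transfer, .Ar_args, .K46] [.K48] &&
  (okE Atom.idx v [.Ch1, .Ch3, .Glob, .MokMain, .TF_analytic, .Transfer, .EPIT_published, .Ar_args, .K48] [.K49] &&
  (okE Atom.idx v [.Ch1, .Ch3, .T161g, .LIRg, .MokMain, .T164] [.K50] &&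
  (okE Atom.idx v [.K22, .K23, .K24, .K25, .K26, .K27, .K28, .K29] [.Ch2] &&
  (okE Atom.idx v [.K41, .K42, .K43, .K44] [.Glob] &&
  (okE Atom.idx v [.K31, .K32, .K33, .K34, .K35, .K36, .K37, .K38] [.Ch3] &&
  (okE Atom.idx v [.K45, .K46] [.LIRg] &&
  (okE Atom.idx v [.Ch1, .K47, .K48, .K49] [.T161g] &&
  (okE Atom.idx v [.K50] [.T171p]))))))))))))))))))))))))))))))))))))))))))

/-- SOUNDNESS OF THE CLAUSE READING: if the clauses hold in the valuation `v`, every edge hypothesis holds for the valuation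
structures (at every rank; the induction-hypothesis premise is not used). [folklore] (bookkeeping proved here) -/
theorem systems_of_check (v : Nat) (h : checkAll v = true) : Systems (mkN v) (mkW v) :=
  have o : Oks v := by
    simp only [checkAll, Bool.and_eq_true] at h
    obtain ⟨h0, h1, h2, h3, h4, h5, h6, h7, h8, h9, h10, h11, h12, h13, h14, h15, h16, h17, h18, h19, h20, h21, h22, h23, h24, h25, h26, h27, h28, h29, h30, h31, h32, h33, h34, h35, h36, h37, h38, h39, h40, h41, h42⟩ := h
    exact ⟨h0, h1, h2, h3, h4, h5, h6, h7, h8, h9, h10, h11, h12, h13, h14, h15, h16, h17, h18, h19, h20, h21, h22, h23, h24, h25, h26, h27, h28, h29, h30, h31, h32, h33, h34, h35, h36, h37, h38, h39, h40, h41, h42⟩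
  { chapter :=
      { ch1 := fun _ h1 h2 h3 h4 h5 => (sound o.chapter_ch1 ⟨h1, h2, h3, h4, h5, trivial⟩).1
        glob := fun _ _ h1 h2 h3 h4 h5 h6 h7 => (sound o.chapter_glob ⟨h1, h2, h3, h4, h5, h6, h7, trivial⟩).1
        ch2 := fun _ _ h1 h2 h3 h4 h5 h6 h7 h8 => (sound o.chapter_ch2 ⟨h1, h2, h3, h4, h5, h6, h7, h8, trivial⟩).1
        ch3 := fun _ _ h1 h2 h3 h4 h5 h6 h7 h8 h9 h10 => (sound o.chapter_ch3 ⟨h1, h2, h3, h4, h5, h6, h7, h8, h9, h10, trivial⟩).1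
        ch4lir := fun _ _ h1 h2 h3 h4 h5 h6 h7 h8 h9 => (sound o.chapter_ch4lir ⟨h1, h2, h3, h4, h5, h6, h7, h8, h9, trivial⟩).1
        ch4loc := fun _ _ h1 h2 h3 h4 h5 h6 h7 h8 h9 h10 => (sound o.chapter_ch4loc ⟨h1, h2, h3, h4, h5, h6, h7, h8, h9, h10, trivial⟩).1
        ch5 := fun _ _ h1 h2 h3 h4 h5 h6 => (sound o.chapter_ch5 ⟨h1, h2, h3, h4, h5, h6, trivial⟩).1 }
    supply :=
      { stabOrd := fun h1 h2 h3 h4 h5 => (sound o.supply_stabOrd ⟨h1, h2, h3, h4, h5, trivial⟩).1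
        t164 := fun h1 h2 h3 => (sound o.supply_t164 ⟨h1, h2, h3, trivial⟩).1
        appA := fun h1 h2 => (sound o.supply_appA ⟨h1, h2, trivial⟩).1
        full := fun h1 h2 h3 _ g4 => have s := sound o.supply_full ⟨h1, h2, h3, g4.1, g4.2.1, g4.2.2.1, g4.2.2.2.1, g4.2.2.2.2.1, g4.2.2.2.2.2.1, g4.2.2.2.2.2.2, trivial⟩; ⟨s.1, s.2.1, s.2.2.1⟩ }
    fine :=
      { kf41 := fun _ h1 h2 h3 => (sound o.fine_kf41 ⟨h1, h2, h3, trivial⟩).1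
        kf42 := fun _ h1 h2 => (sound o.fine_kf42 ⟨h1, h2, trivial⟩).1
        kf43 := fun _ h1 h2 h3 => (sound o.fine_kf43 ⟨h1, h2, h3, trivial⟩).1
        kf22 := fun _ _ h1 h2 h3 h4 h5 h6 => (sound o.fine_kf22 ⟨h1, h2, h3, h4, h5, h6, trivial⟩).1
        kf23 := fun _ _ h1 h2 h3 h4 h5 h6 => (sound o.fine_kf23 ⟨h1, h2, h3, h4, h5, h6, trivial⟩).1
        kf24 := fun _ _ h1 h2 h3 h4 h5 h6 h7 h8 => (sound o.fine_kf24 ⟨h1, h2, h3, h4, h5, h6, h7, h8, trivial⟩).1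
        kf25 := fun _ h1 h2 h3 h4 => (sound o.fine_kf25 ⟨h1, h2, h3, h4, trivial⟩).1
        kf26 := fun _ _ h1 h2 h3 h4 h5 h6 h7 h8 => (sound o.fine_kf26 ⟨h1, h2, h3, h4, h5, h6, h7, h8, trivial⟩).1
        kf27 := fun _ _ h1 h2 h3 h4 h5 h6 h7 h8 h9 => (sound o.fine_kf27 ⟨h1, h2, h3, h4, h5, h6, h7, h8, h9, trivial⟩).1
        kf28 := fun _ _ h1 h2 h3 h4 h5 h6 h7 => (sound o.fine_kf28 ⟨h1, h2, h3, h4, h5, h6, h7, trivial⟩).1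
        kf29 := fun _ h1 h2 h3 h4 h5 h6 h7 => (sound o.fine_kf29 ⟨h1, h2, h3, h4, h5, h6, h7, trivial⟩).1
        kf44 := fun _ h1 h2 h3 h4 h5 h6 h7 => (sound o.fine_kf44 ⟨h1, h2, h3, h4, h5, h6, h7, trivial⟩).1
        kf31 := fun _ h1 h2 h3 h4 h5 h6 => (sound o.fine_kf31 ⟨h1, h2, h3, h4, h5, h6, trivial⟩).1
        kf32 := fun _ h1 h2 h3 => (sound o.fine_kf32 ⟨h1, h2, h3, trivial⟩).1
        kf33 := fun _ _ h1 h2 h3 h4 h5 => (sound o.fine_kf33 ⟨h1, h2, h3, h4, h5, trivial⟩).1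
        kf34 := fun _ _ h1 h2 h3 => (sound o.fine_kf34 ⟨h1, h2, h3, trivial⟩).1
        kf35 := fun _ _ h1 h2 h3 h4 h5 h6 h7 h8 h9 => (sound o.fine_kf35 ⟨h1, h2, h3, h4, h5, h6, h7, h8, h9, trivial⟩).1
        kf36 := fun _ _ h1 h2 h3 h4 h5 h6 h7 h8 => (sound o.fine_kf36 ⟨h1, h2, h3, h4, h5, h6, h7, h8, trivial⟩).1
        kf37 := fun _ _ h1 h2 h3 h4 h5 => (sound o.fine_kf37 ⟨h1, h2, h3, h4, h5, trivial⟩).1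
        kf38 := fun _ h1 h2 h3 h4 => (sound o.fine_kf38 ⟨h1, h2, h3, h4, trivial⟩).1
        kf45 := fun _ h1 h2 h3 h4 h5 => (sound o.fine_kf45 ⟨h1, h2, h3, h4, h5, trivial⟩).1
        kf46 := fun _ _ h1 h2 h3 h4 h5 h6 h7 h8 => (sound o.fine_kf46 ⟨h1, h2, h3, h4, h5, h6, h7, h8, trivial⟩).1
        kf47 := fun _ _ h1 h2 h3 h4 h5 h6 h7 h8 => (sound o.fine_kf47 ⟨h1, h2, h3, h4, h5, h6, h7, h8, trivial⟩).1
        kf48 := fun _ _ h1 h2 h3 h4 h5 h6 h7 h8 => (sound o.fine_kf48 ⟨h1, h2, h3, h4, h5, h6, h7, h8, trivial⟩).1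
        kf49 := fun _ _ h1 h2 h3 h4 h5 h6 h7 h8 h9 => (sound o.fine_kf49 ⟨h1, h2, h3, h4, h5, h6, h7, h8, h9, trivial⟩).1
        kf50 := fun _ h1 h2 h3 h4 h5 h6 => (sound o.fine_kf50 ⟨h1, h2, h3, h4, h5, h6, trivial⟩).1 }
    readings :=
      { kr2 := fun _ h1 h2 h3 h4 h5 h6 h7 h8 => (sound o.readings_kr2 ⟨h1, h2, h3, h4, h5, h6, h7, h8, trivial⟩).1
        krGlob := fun _ h1 h2 h3 h4 => (sound o.readings_krGlob ⟨h1, h2, h3, h4, trivial⟩).1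
        kr3 := fun _ h1 h2 h3 h4 h5 h6 h7 h8 => (sound o.readings_kr3 ⟨h1, h2, h3, h4, h5, h6, h7, h8, trivial⟩).1
        krLIR := fun _ h1 h2 => (sound o.readings_krLIR ⟨h1, h2, trivial⟩).1
        krLoc := fun _ h1 h2 h3 h4 => (sound o.readings_krLoc ⟨h1, h2, h3, h4, trivial⟩).1
        kr5 := fun _ h1 => (sound o.readings_kr5 ⟨h1, trivial⟩).1 } }

/-! ## 4. The 14 leaves and the main theorems -/

/-- The 14 leaves = the fields of `PublishedLeaves` (10), `ImportedLeaves` (1), `UnwrittenLeaves` (1), `UnwrittenSequels` (2), in that order. [folklore] (bookkeeping: leaf inventory of the module) -/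
inductive Leaf where
  | GL_inner | Transfer | FL | WFL_split | STF_Arthur | TF_analytic | EPIT_published | Glob_inputs | AubertSS
  | Ar_args | MokMain | WFL_general | KMS_A | KMS_B
  deriving DecidableEq

/-- The atom of a leaf. [folklore] (bookkeeping) -/
def Leaf.toAtom : Leaf → Atom
  | .GL_inner => .GL_inner | .Transfer => .Transfer | .FL => .FL | .WFL_split => .WFL_split
  | .STF_Arthur => .STF_Arthur | .TF_analytic => .TF_analytic | .EPIT_published => .EPIT_published
  | .Glob_inputs => .Glob_inputs | .AubertSS => .AubertSS | .Ar_args => .Ar_args | .MokMain => .MokMain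
  | .WFL_general => .WFL_general | .KMS_A => .KMS_A | .KMS_B => .KMS_B

/-- The proposition a leaf names in given `Nodes`. [folklore] (bookkeeping) -/
def _root_.Literature.NumberTheory.Automorphic.KMSW2014.Nodes.leaf (ν : Nodes) : Leaf → Prop
  | .GL_inner => ν.GL_inner | .Transfer => ν.Transfer | .FL => ν.FL | .WFL_split => ν.WFL_split
  | .STF_Arthur => ν.STF_Arthur | .TF_analytic => ν.TF_analytic | .EPIT_published => ν.EPIT_published
  | .Glob_inputs => ν.Glob_inputs | .AubertSS => ν.AubertSS | .Ar_args => ν.Ar_args | .MokMain => ν.MokMain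
  | .WFL_general => ν.WFL_general | .KMS_A => ν.KMS_A | .KMS_B => ν.KMS_B

/-- The leaf bundles say exactly "every leaf holds". [folklore] (bookkeeping proved here) -/
theorem leaves_iff (ν : Nodes) :
    (ν.PublishedLeaves ∧ ν.ImportedLeaves ∧ ν.UnwrittenLeaves ∧ ν.UnwrittenSequels) ↔ ∀ l : Leaf, ν.leaf l := by
  constructor
  · intro ⟨P, I, U, Q⟩ l
    cases l
    · exact P.gl
    · exact P.transfer
    · exact P.fl
    · exact P.wfl_split
    · exact P.stf
    · exact P.tf
    · exact P.epit
    · exact P.globi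
    · exact P.aubert
    · exact P.arArgs
    · exact I.mok
    · exact U.wfl_general
    · exact Q.kmsA
    · exact Q.kmsB
  · intro h
    exact ⟨⟨h .GL_inner, h .Transfer, h .FL, h .WFL_split, h .STF_Arthur, h .TF_analytic, h .EPIT_published, h .Glob_inputs, h .AubertSS, h .Ar_args⟩, ⟨h .MokMain⟩, ⟨h .WFL_general⟩, ⟨h .KMS_A, h .KMS_B⟩⟩

/-- Under the valuation structures a leaf reads as its bit. [folklore] (bookkeeping) -/
theorem leaf_mk (v : Nat) : ∀ l : Leaf, (mkN v).leaf l ↔ bit Atom.idx v l.toAtom := by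
  intro l; cases l <;> exact Iff.rfl

/-- Conjunction over all 14 leaves of a Boolean test (a fold written out, so that unpacking it needs no list lemmas). [folklore] (bookkeeping) -/
def Leaf.kmswAllB (p : Leaf → Bool) : Bool :=
  p .GL_inner &&
  (p .Transfer &&
  (p .FL &&
  (p .WFL_split &&
  (p .STF_Arthur &&
  (p .TF_analytic &&
  (p .EPIT_published &&
  (p .Glob_inputs &&
  (p .AubertSS &&
  (p .Ar_args &&
  (p .MokMain &&
  (p .WFL_general &&
  (p .KMS_A &&
  (p .KMS_B)))))))))))))

/-- `Leaf.kmswAllB p` says `p` holds at every leaf. [folklore] (bookkeeping) -/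
theorem Leaf.kmswAllB_iff (p : Leaf → Bool) : Leaf.kmswAllB p = true ↔ ∀ l, p l = true := by
  constructor
  · intro h l
    simp only [Leaf.kmswAllB, Bool.and_eq_true] at h
    obtain ⟨h0, h1, h2, h3, h4, h5, h6, h7, h8, h9, h10, h11, h12, h13⟩ := h
    cases l <;> assumption
  · intro h; simp [Leaf.kmswAllB, h]

/-- Boolean test: every leaf other than `l` holds in the valuation `v`. [folklore] (bookkeeping) -/
def kmswOthersB (v : Nat) (l : Leaf) : Bool := Leaf.kmswAllB fun l' => decide (l' = l) || v.testBit l'.toAtom.idx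

/-- Soundness of `kmswOthersB`. [folklore] (bookkeeping) -/
theorem others_of_kmswOthersB (v : Nat) (l : Leaf) (h : kmswOthersB v l = true) : ∀ l', l' ≠ l → (mkN v).leaf l' := by
  intro l' hne
  have h' := (Leaf.kmswAllB_iff _).1 h l'
  simp [hne] at h'
  exact (leaf_mk v l').2 h'

/-- NONE of the main theorems `T161`, `LIR`, `T171` holds at rank `N` — the main theorems whose least-model support is EVERY leaf; the remaining ones (`T161g`, `LIRg`, `T171p`) fail in all countermodels but those of `AubertSS`, `KMS_A`, `KMS_B` (query them with `necessary`). [folklore] (bookkeeping) -/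
def _root_.Literature.NumberTheory.Automorphic.KMSW2014.Nodes.NoFull (ν : Nodes) (N : Nat) : Prop :=
  ¬ ν.T161 N ∧ ¬ ν.LIR N ∧ ¬ ν.T171 N

/-- `NoFull` refutes `Full`. [folklore] (bookkeeping) -/
theorem not_full_of_noFull {ν : Nodes} {N : Nat} (h : ν.NoFull N) : ¬ ν.Full N :=
  fun a => h.1 a.1

/-- The main-theorem atoms refuted in every countermodel. [folklore] (bookkeeping) -/
def fullMains : List Atom := [.T161, .LIR, .T171]

/-- Reading `NoFull` off the valuation. [folklore] (bookkeeping) -/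
theorem noFull_mk (v N : Nat) (h : noneB Atom.idx v fullMains = true) : (mkN v).NoFull N :=
  have p := noneP_of_noneB Atom.idx v fullMains h
  ⟨p.1, p.2.1, p.2.2.1⟩

/-! ## 5. The 14 countermodels: least model of the edge system over all leaves but one, IH granted -/

/-- For each leaf `l`, the valuation numeral of the LEAST set of atoms containing every other leaf and closed under all
edge clauses (forward chaining by the cell script; certified below by `decide`, not trusted). [folklore] (bookkeeping) -/
def cm : Leaf → Nat
  | .GL_inner => 98301
  | .Transfer => 81915
  | .FL => 132250557595639
  | .WFL_split => 132250557595631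
  | .STF_Arthur => 132250557595615
  | .TF_analytic => 61572659609535
  | .EPIT_published => 98175
  | .Glob_inputs => 9311497617151
  | .AubertSS => 9007199247334911
  | .Ar_args => 53051444558847
  | .MokMain => 131070
  | .WFL_general => 132250557593599
  | .KMS_A => 9007199247396863
  | .KMS_B => 9007199247392767

/-- KERNEL CERTIFICATE per leaf: the countermodel satisfies every edge bundle and every other leaf, while the removed leaf
and the main theorems of `NoFull` fail at every rank. [folklore] (bookkeeping proved here: necessity of each leaf in the DAG as typed) -/
theorem countermodel (l : Leaf) :
    Systems (mkN (cm l)) (mkW (cm l)) ∧ (∀ l', l' ≠ l → (mkN (cm l)).leaf l') ∧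
    ¬ (mkN (cm l)).leaf l ∧ ∀ N, (mkN (cm l)).NoFull N := by
  cases l <;> exact ⟨systems_of_check _ (by decide), others_of_kmswOthersB _ _ (by decide),
    fun h => absurd ((leaf_mk _ _).1 h) (by decide), fun N => noFull_mk _ N (by decide)⟩

/-! ## 5b. The remaining main theorems: `T161g`, `LIRg`, `T171p` -/

/-- NONE of the PROVED SCOPE (Thm* 1.6.1 generic, the LIR for bounded parameters with E/F a field, Thm 5.0.1 generic: `T161g`, `LIRg`, `T171p`) holds at rank `N`. [folklore] (bookkeeping) -/
def _root_.Literature.NumberTheory.Automorphic.KMSW2014.Nodes.NoScope (ν : Nodes) (N : Nat) : Prop :=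
  ¬ ν.T161g N ∧ ¬ ν.LIRg N ∧ ¬ ν.T171p N

/-- `NoScope` refutes `Scope`. [folklore] (bookkeeping) -/
theorem not_scope_of {ν : Nodes} {N : Nat} (h : ν.NoScope N) : ¬ ν.Scope N :=
  fun a => h.1 a.1

/-- The atoms of the PROVED SCOPE (Thm* 1.6.1 generic, the LIR for bounded parameters with E/F a field, Thm 5.0.1 generic: `T161g`, `LIRg`, `T171p`). [folklore] (bookkeeping) -/
def scopeMains : List Atom := [.T161g, .LIRg, .T171p]

/-- Reading `NoScope` off the valuation. [folklore] (bookkeeping) -/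
theorem noScope_mk (v N : Nat) (h : noneB Atom.idx v scopeMains = true) : (mkN v).NoScope N :=
  have p := noneP_of_noneB Atom.idx v scopeMains h
  ⟨p.1, p.2.1, p.2.2.1⟩

/-- The 3 leaf/leaves whose removal does NOT (at fixed rank, IH granted) destroy `T161g`, `LIRg`, `T171p`: `AubertSS`, `KMS_A`, `KMS_B` —
in the least model without such a leaf those atoms are still derived (bit set in `cm`), i.e. the leaf enters only the derivations of `T161`, `LIR`, `T171`. [folklore] (bookkeeping) -/
def Leaf.onlyFull : Leaf → Bool
  | .AubertSS => true | .KMS_A => true | .KMS_B => true | _ => false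

/-- KERNEL CERTIFICATE, second tier: for every leaf NOT flagged by `Leaf.onlyFull`, its countermodel also refutes `T161g`, `LIRg`, `T171p`
at every rank. [folklore] (bookkeeping proved here) -/
theorem scope_fails (l : Leaf) (h : l.onlyFull = false) : ∀ N, (mkN (cm l)).NoScope N := by
  cases l <;> first | exact absurd h (by decide) | exact fun N => noScope_mk _ N (by decide)

/-- LEAF ESSENTIALITY, second tier: every leaf not flagged by `Leaf.onlyFull` is load-bearing for the PROVED SCOPE (Thm* 1.6.1 generic, the LIR for bounded parameters with E/F a field, Thm 5.0.1 generic: `T161g`, `LIRg`, `T171p`) as well —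
a model of every edge bundle and every other leaf in which the leaf and ALL main theorems fail at every rank. [folklore] (bookkeeping proved here) -/
theorem leaf_essential_scope (l : Leaf) (h : l.onlyFull = false) :
    ∃ (ν : Nodes) (ω : Waypoints), Systems ν ω ∧ (∀ l', l' ≠ l → ν.leaf l') ∧ ¬ ν.leaf l ∧ ∀ N, ν.NoFull N ∧ ν.NoScope N :=
  ⟨_, _, (countermodel l).1, (countermodel l).2.1, (countermodel l).2.2.1,
    fun N => ⟨(countermodel l).2.2.2 N, scope_fails l h N⟩⟩

/-- No unflagged leaf is redundant for `Scope` either. [folklore] (bookkeeping proved here) -/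
theorem not_derivable_scope_without (l : Leaf) (h : l.onlyFull = false) :
    ¬ (∀ (ν : Nodes) (ω : Waypoints), Systems ν ω → (∀ l', l' ≠ l → ν.leaf l') → ∃ N, ν.Scope N) := by
  intro H
  obtain ⟨N, hN⟩ := H _ _ (countermodel l).1 (countermodel l).2.1
  exact not_scope_of (scope_fails l h N) hN

/-! ## 6. Consequences -/

/-- LEAF ESSENTIALITY: for every leaf there is a model of every edge bundle and every OTHER leaf in which the leaf fails and
the main theorems of `NoFull` fail at every rank — no such leaf can be dropped from the landed composition theorems AS TYPED.
A statement about the cell's TRANSCRIPTION of the dependency structure, not about the mathematics. [folklore] (bookkeeping proved here) -/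
theorem leaf_essential (l : Leaf) :
    ∃ (ν : Nodes) (ω : Waypoints), Systems ν ω ∧ (∀ l', l' ≠ l → ν.leaf l') ∧ ¬ ν.leaf l ∧ ∀ N, ν.NoFull N :=
  ⟨_, _, countermodel l⟩

/-- No leaf is redundant for `Full`: the edge system and the other leaves do not give even one rank at which `Full` holds. [folklore] (bookkeeping proved here) -/
theorem not_derivable_without (l : Leaf) :
    ¬ (∀ (ν : Nodes) (ω : Waypoints), Systems ν ω → (∀ l', l' ≠ l → ν.leaf l') → ∃ N, ν.Full N) := by
  intro H
  obtain ⟨N, hN⟩ := H _ _ (countermodel l).1 (countermodel l).2.1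
  exact not_full_of_noFull ((countermodel l).2.2.2 N) hN

/-! ## 7. Necessity for ANY node: reading the support table off the countermodels -/

/-- QUERY LEMMA.  If bit `a.idx` of `cm l` is clear, atom `a` fails at every rank in a model of all edges and all leaves but
`l`: leaf `l` is in the least-model support of `a`.  Usage: `necessary <leaf> <atom> (by decide)`; table in the module docstring. [folklore] (bookkeeping proved here) -/
theorem necessary (l : Leaf) (a : Atom) (h : (cm l).testBit a.idx = false) :
    Systems (mkN (cm l)) (mkW (cm l)) ∧ (∀ l', l' ≠ l → (mkN (cm l)).leaf l') ∧
      ∀ N, ¬ a.prop (mkN (cm l)) (mkW (cm l)) N :=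
  ⟨(countermodel l).1, (countermodel l).2.1, fun N hp => by
    have hb := (prop_mk _ N a).1 hp
    simp [bit, h] at hb⟩

end LeafSupport

end Literature.NumberTheory.Automorphic.KMSW2014
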